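import Summits.ResolutionOfSingularities.ResolutionOfSingularities.Theorems.WallTransport2
import HarnessLib

/-!
# WallExit — decomp-res node «WallCut» (lens-4 g30, critic rows 176/176a CLEARED DECIDED +1), tree file 5/8 of the node

Content VERBATIM from the decomp-res lens-4 g30 node `HOME/decomp-res-lens-4/g30/WallCut.lean` (pin c43ccc48;
imports the landed tree only, carries nothing);
HOME = run/shared/lean/pub/decomp-res; critic rows 176/176a CLEARED DECIDED +1; landing orders INBOX :819 —
provenance, critic text and the lens header in full in the first file of the
node, `WallAlgebra`.  Namespace `…Theorems.HugValuationCut`; `--supports stmt-ResolutionOfSingularities-28338`.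

## This file

§83 (NEW, KERNEL) THE FREE EXIT POINT IS FATAL — `section FreeExit`: at the free exit at `e = 1` the successor class
is empty (`twoWall_point_fatal`, with its `set_option maxHeartbeats 1600000 in` prefix VERBATIM).

[WRITER NOTE (decomp-res writer g11): file split only (tree files ≤ 400 lines); namespace, universes, sections,
section variables and every declaration
exactly as in the lens (the node's global dupNamespace-linter line is dropped — the library sets it; the `open
…Theses` line lives only in the Theses-cone file;
`set_option maxHeartbeats … in` prefixes of single declarations are kept VERBATIM).  ONE deletion (gate dedup rule,
critic :835 watch-list): the node's private copy of
isUnit_add_of_mem_maximalIdeal` is NOT re-landed — it is LITERALLY the landed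
`Literature.AlgebraicGeometry.Resolution.isUnit_add_of_mem_maximalIdeal` (`WeightedInitialTerms`,
imported; the namespace is opened as in the lens), which the transport proofs now cite by the same short name.
SECOND deletion (gate dedup bounce p810318):
the node's `range_triple` is NOT re-landed — it is LITERALLY the landed
`…Cruxes.HypersurfaceCentreConstruction.LocalEngine.Iota3.range_vec₃`
(`Theorems/WeightedInvariantIota3FlagTools`, imported from `WallAlgebra2` on; aliased by an explicit `open …
(range_vec₃)`), cited by name at its two uses.]

(Sources: Hauser2010Kangaroo (arXiv:0811.4151, Kangaroo Theorem condition (3)); HauserPerlega2019 §2; Hauser2024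
PRIMS 60; Moh1987; Perlega2023; Matsumura1987 Thms. 14.2–14.3, 19.x; ZariskiSamuel1960 VIII §11; StacksProject Tags
0804, 0BIQ, 00NQ, 0AGS; DeJong1996 2.4; CossartPiltant2008 §2; Giraud1975.)
-/

noncomputable section

open CategoryTheory AlgebraicGeometry IsLocalRing
open Literature.AlgebraicGeometry.Resolution
open Summit.ResolutionOfSingularities.ResolutionOfSingularities.Theorems
open WeakOrderReduction ForcedTowerClasses DivergentTowerClasses MonomialTowerClasses
open HugDimensionClasses HugDimensionKernels SurfaceShadowClasses SurfaceShadowKernels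
open NearPointCut (SingularClass)
open scoped BigOperators
open Summit.ResolutionOfSingularities.ResolutionOfSingularities.Cruxes.HypersurfaceCentreConstruction.LocalEngine.Iota3 (range_vec₃)

namespace Summit.ResolutionOfSingularities.ResolutionOfSingularities.Theorems.HugValuationCut

section FreeExit

variable {X X' : Scheme.{0}} {π : X' ⟶ X} {C : X.IdealSheafData}

set_option maxHeartbeats 1600000 in

/-- **THE FREE EXIT POINT IS FATAL (KERNEL, PROVED; characteristic 2, weight 2, ring dimension 3 upstairs).**  In the setting
of the exit law (`TwoWallAt 𝓘 W V H e x`, `y` a marked class point over `x` OFF the weak transform of the kept wall — hence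
`e = 1` and `y` off the other wall too, `twoWall_point_exit`), if moreover `X'` is regular of ring dimension `≥ 3`
at `y`, there is
NO such `y` at all.  PROOF: the explicit chart round on the full system `(w, v, z)`: `y` lies in the chart of `w` or of `v` (not
of `z`: `z' ∈ 𝔪_y`), the transported cofactor `g₁ = π^*u·v₁ + π^*a·w₁ + π^*b·z'` (`w₁, v₁` units) is either a unit — then
`w₀ = π^*c z'² + s·unit` has order `1` — or lies in `𝔪_y`, and then the free chart coordinate is RATIONAL over `x`
(`v₁ ≡ −a/u` resp. `w₁ ≡ −u/a`), so `𝔪_y = (s, g₁, z')` (`chart_ideal_eq_of_rational`): `(s, w₁v₁g₁, z')` is a regular system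
of parameters (dimension `3`) and `w₀ = π^*c·z'² + s·(w₁v₁g₁)·1` contradicts the `2`-power form by the EXIT LEMMA once more.
(Sources: Hauser2010Kangaroo, «kangaroo points»; Matsumura1987, Thm. 14.2; StacksProject, Tags 052P, 0BIQ.) -/
theorem twoWall_point_fatal (hπ : IsBlowup π C) [IsLocallyNoetherian X] [IsLocallyNoetherian X']
    (hX : Scheme.IsRegular X) (hX' : Scheme.IsRegular X') (hCreg : Scheme.IsRegular C.subscheme)
    (I W V H : X.IdealSheafData) {e : ℕ}
    (y : X') (hcl : IsClosed ({π y} : Set X)) (hpt : (C.support : Set X) = {π y})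
    (hIn : stalkIdeal I (π y) ≤ maximalIdeal _ ^ 2)
    (hI'2 : stalkIdeal (controlledTransform π C I 2) y ≤ maximalIdeal _ ^ 2)
    (hdim3 : (3 : WithBot ℕ∞) ≤ ringKrullDim (X'.presheaf.stalk y))
    [CharP (X'.presheaf.stalk y) 2] (hPP : PPowerFormAt 2 (controlledTransform π C I 2) 2 y)
    (h : TwoWallAt I W V H e (π y)) (hfree : y ∉ (controlledTransform π C W 1).support) : False := by
  obtain ⟨he1, hVfree⟩ := twoWall_point_exit hπ hX hCreg I W V H y hcl hpt hIn hI'2 hPP h hfree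
  subst he1
  obtain ⟨w, v, z, hWw, hVv, hHz, hrs, hfull, f, hfI, c₀, g, hc, hft, u, a, b, hu, ha, -, hg⟩ := h
  haveI : IsRegularLocalRing (X.presheaf.stalk (π y)) := hX _
  haveI : IsRegularLocalRing (X'.presheaf.stalk y) := hX' _
  have hCst : stalkIdeal C (π y) = maximalIdeal _ := by
    rw [eq_vanishingIdeal_support_of_isRegular C hCreg]
    apply stalkIdeal_vanishingIdeal_eq_maximalIdeal_of_closure_eq
    rw [hpt, hcl.closure_eq]
  have hzm : z ∈ maximalIdeal (X.presheaf.stalk (π y)) := by simpa using hrs.mem_maximalIdeal 2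
  have hz2 : z ∉ maximalIdeal (X.presheaf.stalk (π y)) ^ 2 := by simpa using hrs.not_mem_sq 2
  -- THE EXPLICIT CHART ROUND on the full regular system `c = (w, v, z)` of `𝒪_x`
  set c : Fin 3 → X.presheaf.stalk (π y) := ![w, v, z] with hcdef
  have hc0 : c 0 = w := rfl
  have hc1 : c 1 = v := rfl
  have hc2 : c 2 = z := rfl
  have hcC : Ideal.span (Set.range c) = stalkIdeal C (π y) := by rw [hcdef, range_vec₃, hfull, hCst]
  obtain ⟨i, 𝔴, χ, hχ, hloc, h𝔴⟩ := hπ.exists_reesChart_stalk y c hcC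
  obtain ⟨hE, hW'⟩ := hπ.stalkIdeal_controlledTransform_eq_span_chartGen y c hcC {0}
    (by rw [Set.image_singleton, hc0, hWw]) i 𝔴 χ hχ hloc
  obtain ⟨-, hV'⟩ := hπ.stalkIdeal_controlledTransform_eq_span_chartGen y c hcC {1}
    (by rw [Set.image_singleton, hc1, hVv]) i 𝔴 χ hχ hloc
  obtain ⟨-, hH'⟩ := hπ.stalkIdeal_controlledTransform_eq_span_chartGen y c hcC {2}
    (by rw [Set.image_singleton, hc2, hHz]) i 𝔴 χ hχ hloc
  rw [Set.image_singleton] at hW' hV' hH'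
  letI alg : Algebra (chartRing c i) (X'.presheaf.stalk y) := χ.toAlgebra
  haveI : IsLocalization.AtPrime (X'.presheaf.stalk y) 𝔴.asIdeal := hloc
  haveI : 𝔴.asIdeal.IsPrime := 𝔴.isPrime
  have halg : ∀ b', algebraMap (chartRing c i) (X'.presheaf.stalk y) b' = χ b' := fun b' => by
    rw [RingHom.algebraMap_toAlgebra]
  set σ := (π.stalkMap y).hom with hσ
  set s : X'.presheaf.stalk y := χ (chartBase c i (c i)) with hsdef
  set w₁ : X'.presheaf.stalk y := χ (chartGen c i 0) with hw₁def
  set v₁ : X'.presheaf.stalk y := χ (chartGen c i 1) with hv₁def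
  set z' : X'.presheaf.stalk y := χ (chartGen c i 2) with hz'def
  have hcj : ∀ j, σ (c j) = s * χ (chartGen c i j) := fun j => by
    rw [hσ, ← hχ, reesChartBase_apply_eq_mul_chartGen c i j, map_mul]
  have hii : χ (chartGen c i i) = 1 := by rw [show chartGen c i i = 1 from chartGen_self c i, map_one]
  have hww : σ w = s * w₁ := by rw [← hc0]; exact hcj 0
  have hvv : σ v = s * v₁ := by rw [← hc1]; exact hcj 1
  have hzz' : σ z = s * z' := by rw [← hc2]; exact hcj 2
  have hnzd : s ∈ nonZeroDivisors (X'.presheaf.stalk y) := by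
    rw [hsdef, ← halg]
    exact IsLocalization.nonZeroDivisors_le_comap 𝔴.asIdeal.primeCompl _ (reesChartBase_mem_nonZeroDivisors _ _)
  have hEm : (maximalIdeal (X.presheaf.stalk (π y))).map σ = Ideal.span {s} := by
    rw [← hCst, ← stalkIdeal_comap_eq_map_stalkMap, hE]
  have hmle : (maximalIdeal (X.presheaf.stalk (π y))).map σ ≤ maximalIdeal (X'.presheaf.stalk y) :=
    Ideal.map_le_iff_le_comap.mpr fun a ha => Ideal.mem_comap.mpr (map_nonunit σ a ha)
  have hsm : s ∈ maximalIdeal (X'.presheaf.stalk y) := hmle (by rw [hEm]; exact Ideal.mem_span_singleton_self s)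
  -- `w₁`, `v₁` are UNITS: `y` is off both weak transforms
  have hw₁u : IsUnit w₁ := by
    by_contra hw
    have hw₁m : w₁ ∈ maximalIdeal _ := (IsLocalRing.mem_maximalIdeal _).mpr (mem_nonunits_iff.mpr hw)
    apply hfree
    rw [mem_support_iff_stalkIdeal_le, hW', Ideal.span_le, Set.singleton_subset_iff]
    exact hw₁m
  have hv₁u : IsUnit v₁ := by
    by_contra hv
    have hv₁m : v₁ ∈ maximalIdeal _ := (IsLocalRing.mem_maximalIdeal _).mpr (mem_nonunits_iff.mpr hv)
    apply hVfree
    rw [mem_support_iff_stalkIdeal_le, hV', Ideal.span_le, Set.singleton_subset_iff]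
    exact hv₁m
  -- `π^* f = w₀ s²`, `w₀ ∈ 𝓘'_y`
  have hσf : σ f ∈ Ideal.span {s ^ 2} := by
    have hm : σ f ∈ (maximalIdeal _ ^ 2).map σ := Ideal.mem_map_of_mem _ (hIn hfI)
    rwa [Ideal.map_pow, hEm, Ideal.span_singleton_pow] at hm
  obtain ⟨w₀, hw₀⟩ := Ideal.mem_span_singleton'.mp hσf
  have hI' : stalkIdeal (controlledTransform π C I 2) y =
      Submodule.colon ((stalkIdeal I (π y)).map σ) {s ^ 2} := by
    rw [hπ.stalkIdeal_controlledTransform I 2 y, stalkIdeal_comap_eq_map_stalkMap, hE,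
      Ideal.span_singleton_pow, Submodule.colon_span]
  have hw₀I' : w₀ ∈ stalkIdeal (controlledTransform π C I 2) y := by
    rw [hI', Submodule.mem_colon_singleton, smul_eq_mul, hw₀]
    exact Ideal.mem_map_of_mem _ hfI
  -- the transported cofactor `π^* g = s · g₁` (`e = 1`)
  set g₁ : X'.presheaf.stalk y := σ u * v₁ + σ a * w₁ + σ b * z' with hg₁
  have hσg : σ g = s * g₁ := by
    rw [hg]
    simp only [map_add, map_mul, pow_one]
    rw [hww, hvv, hzz', hg₁]
    ring
  have hkey : w₀ - σ c₀ * z' ^ 2 = w₁ * s * (v₁ * g₁) := by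
    have h1 : s ^ 2 * (w₀ - σ c₀ * z' ^ 2) = s ^ 2 * (w₁ * s * (v₁ * g₁)) := by
      have e1 : σ (f - c₀ * z ^ 2) = σ f - σ c₀ * (s * z') ^ 2 := by rw [map_sub, map_mul, map_pow, hzz']
      have e2 : σ (f - c₀ * z ^ 2) = σ w * σ v * σ g := by rw [hft, map_mul, map_mul]
      calc s ^ 2 * (w₀ - σ c₀ * z' ^ 2) = w₀ * s ^ 2 - σ c₀ * (s * z') ^ 2 := by ring
        _ = σ (f - c₀ * z ^ 2) := by rw [e1, hw₀]
        _ = σ w * σ v * σ g := e2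
        _ = (s * w₁) * (s * v₁) * (s * g₁) := by rw [hww, hvv, hσg]
        _ = s ^ 2 * (w₁ * s * (v₁ * g₁)) := by ring
    exact (mul_cancel_left_mem_nonZeroDivisors (pow_mem hnzd 2)).mp h1
  -- `z' ∈ 𝔪_y`
  have hcu : IsUnit (σ c₀) := hc.map σ
  have hI'1 : stalkIdeal (controlledTransform π C I 2) y ≤ maximalIdeal _ :=
    hI'2.trans (Ideal.pow_le_self (by norm_num))
  have hz'p : σ c₀ * z' ^ 2 ∈ maximalIdeal (X'.presheaf.stalk y) := by
    have h1 : w₀ - w₁ * s * (v₁ * g₁) ∈ maximalIdeal _ :=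
      sub_mem (hI'1 hw₀I') (Ideal.mul_mem_right _ _ (Ideal.mul_mem_left _ _ hsm))
    have e1 : w₀ - w₁ * s * (v₁ * g₁) = σ c₀ * z' ^ 2 := by rw [← hkey]; ring
    rwa [e1] at h1
  have hz'm : z' ∈ maximalIdeal (X'.presheaf.stalk y) :=
    Ideal.IsPrime.mem_of_pow_mem inferInstance 2 ((Ideal.unit_mul_mem_iff_mem _ hcu).mp hz'p)
  -- `s ∉ 𝔪_y²` (the single round on `z`: `(s₃, z₃)` regular with `(s₃) = (s)`)
  obtain ⟨𝔷₃, z₃, hE₃, -, hzz₃, -, hreg₃⟩ := point_round_chart_rsop hπ y hCst hzm hz2 hHz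
  have hs2 : s ∉ maximalIdeal (X'.presheaf.stalk y) ^ 2 := by
    have hspan : Ideal.span {σ 𝔷₃} = Ideal.span {s} := by rw [← hE₃, hE]
    obtain ⟨γ, hγ⟩ : ∃ γ, γ * s = σ 𝔷₃ :=
      Ideal.mem_span_singleton'.mp (by rw [← hspan]; exact Ideal.mem_span_singleton_self _)
    obtain ⟨δ, hδ⟩ : ∃ δ, δ * σ 𝔷₃ = s :=
      Ideal.mem_span_singleton'.mp (by rw [hspan]; exact Ideal.mem_span_singleton_self _)
    have hγδ : δ * γ = 1 := by
      have h1 : s * (δ * γ) = s * 1 := by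
        calc s * (δ * γ) = δ * (γ * s) := by ring
          _ = s * 1 := by rw [hγ, hδ, mul_one]
      exact (mul_cancel_left_mem_nonZeroDivisors hnzd).mp h1
    have hz₃ : z₃ = δ * z' := by
      have h1 : s * z₃ = s * (δ * z') := by
        calc s * z₃ = (δ * γ) * (s * z₃) := by rw [hγδ, one_mul]
          _ = δ * (σ 𝔷₃ * z₃) := by rw [← hγ]; ring
          _ = δ * σ z := by rw [← hzz₃]
          _ = s * (δ * z') := by rw [hzz']; ring
      exact (mul_cancel_left_mem_nonZeroDivisors hnzd).mp h1
    have hz₃m : z₃ ∈ maximalIdeal _ := by rw [hz₃]; exact Ideal.mul_mem_left _ _ hz'm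
    have h3 : σ 𝔷₃ ∉ maximalIdeal _ ^ 2 := by simpa using (hreg₃ hz₃m).2.2.2.not_mem_sq 0
    intro hs
    exact h3 (by rw [← hγ]; exact Ideal.mul_mem_left _ _ hs)
  by_cases hg₁u : IsUnit g₁
  · -- the cofactor is a unit: `w₀ = π^*c z'² + s·unit` has order 1
    have hU : IsUnit (w₁ * (v₁ * g₁)) := hw₁u.mul (hv₁u.mul hg₁u)
    have h1 : s * (w₁ * (v₁ * g₁)) ∈ maximalIdeal (X'.presheaf.stalk y) ^ 2 := by
      have e1 : s * (w₁ * (v₁ * g₁)) = w₀ - σ c₀ * z' ^ 2 := by rw [hkey]; ring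
      rw [e1]
      exact sub_mem (hI'2 hw₀I') (Ideal.mul_mem_left _ _ (Ideal.pow_mem_pow hz'm 2))
    have h2 : (w₁ * (v₁ * g₁)) * s ∈ maximalIdeal (X'.presheaf.stalk y) ^ 2 := by rw [mul_comm]; exact h1
    exact hs2 ((Ideal.unit_mul_mem_iff_mem _ hU).mp h2)
  · -- THE FREE EXIT POINT: `g₁ ∈ 𝔪_y`, and the free chart coordinate is rational over `x`
    have hg₁m : g₁ ∈ maximalIdeal _ := (IsLocalRing.mem_maximalIdeal _).mpr (mem_nonunits_iff.mpr hg₁u)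
    set M : Ideal (X'.presheaf.stalk y) := Ideal.span {s, w₁ * (v₁ * g₁), z'} with hM
    have hMle : M ≤ maximalIdeal (X'.presheaf.stalk y) := by
      rw [hM, Ideal.span_le]
      rintro _ (rfl | rfl | rfl)
      exacts [hsm, Ideal.mul_mem_left _ _ (Ideal.mul_mem_left _ _ hg₁m), hz'm]
    have hg₁M : g₁ ∈ M := by
      obtain ⟨ω, hω⟩ := (hw₁u.mul hv₁u).exists_left_inv
      have e1 : g₁ = ω * (w₁ * (v₁ * g₁)) := by linear_combination (-g₁) * hω
      rw [e1]
      exact Ideal.mul_mem_left _ _ (Ideal.subset_span (by simp))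
    have hz'M : z' ∈ M := Ideal.subset_span (by simp)
    have hsM : s ∈ M := Ideal.subset_span (by simp)
    -- rational coordinates `ℓ₀, ℓ₁`: `w₁ − π^*ℓ₀, v₁ − π^*ℓ₁ ∈ M`
    have hi3 : ∀ j : Fin 3, j = 0 ∨ j = 1 ∨ j = 2 := by decide
    have hrat : ∃ ℓ₀ ℓ₁ : X.presheaf.stalk (π y), w₁ - σ ℓ₀ ∈ M ∧ v₁ - σ ℓ₁ ∈ M := by
      rcases hi3 i with hi | hi | hi
      · -- the chart of `w`: `w₁ = 1`, `v₁ ≡ −a/u`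
        have hw1 : w₁ = 1 := by rw [hw₁def, ← hi]; exact hii
        obtain ⟨u', hu'⟩ := hu.exists_left_inv
        have h1 : σ u' * σ u = 1 := by rw [← map_mul, hu', map_one]
        refine ⟨1, -(u' * a), ?_, ?_⟩
        · rw [map_one, hw1, sub_self]
          exact M.zero_mem
        · have e1 : v₁ - σ (-(u' * a)) = σ u' * g₁ - (σ u' * σ b) * z' := by
            rw [map_neg, map_mul, hg₁, hw1]
            linear_combination (-v₁) * h1
          rw [e1]
          exact M.sub_mem (M.mul_mem_left _ hg₁M) (M.mul_mem_left _ hz'M)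
      · -- the chart of `v`: `v₁ = 1`, `w₁ ≡ −u/a`
        have hv1 : v₁ = 1 := by rw [hv₁def, ← hi]; exact hii
        obtain ⟨a', ha'⟩ := ha.exists_left_inv
        have h1 : σ a' * σ a = 1 := by rw [← map_mul, ha', map_one]
        refine ⟨-(a' * u), 1, ?_, ?_⟩
        · have e1 : w₁ - σ (-(a' * u)) = σ a' * g₁ - (σ a' * σ b) * z' := by
            rw [map_neg, map_mul, hg₁, hv1]
            linear_combination (-w₁) * h1
          rw [e1]
          exact M.sub_mem (M.mul_mem_left _ hg₁M) (M.mul_mem_left _ hz'M)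
        · rw [map_one, hv1, sub_self]
          exact M.zero_mem
      · -- the chart of `z` is impossible: `z' = 1 ∈ 𝔪_y`
        exfalso
        have hz1 : z' = 1 := by rw [hz'def, ← hi]; exact hii
        exact (IsLocalRing.mem_maximalIdeal _).mp hz'm (hz1 ▸ isUnit_one)
    obtain ⟨ℓ₀, ℓ₁, hℓ₀, hℓ₁⟩ := hrat
    have hgenM : ∀ j : Fin 3, χ (chartGen c i j) - σ (![ℓ₀, ℓ₁, 0] j) ∈ M := by
      intro j
      rcases hi3 j with rfl | rfl | rfl
      · rw [show (![ℓ₀, ℓ₁, 0] : Fin 3 → X.presheaf.stalk (π y)) 0 = ℓ₀ from rfl, ← hw₁def]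
        exact hℓ₀
      · rw [show (![ℓ₀, ℓ₁, 0] : Fin 3 → X.presheaf.stalk (π y)) 1 = ℓ₁ from rfl, ← hv₁def]
        exact hℓ₁
      · rw [show (![ℓ₀, ℓ₁, 0] : Fin 3 → X.presheaf.stalk (π y)) 2 = 0 from rfl, map_zero, sub_zero, ← hz'def]
        exact hz'M
    -- the chart ideal `𝔴` is rational over `x`, hence `𝔪_y = 𝔴·𝒪_y ⊆ M`
    let lam : {j : Fin 3 // j ≠ i} → X.presheaf.stalk (π y) := fun j => ![ℓ₀, ℓ₁, 0] j.1
    have hχsub : ∀ j : {j : Fin 3 // j ≠ i},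
        χ (chartGen c i j.1 - chartBase c i (lam j)) = χ (chartGen c i j.1) - σ (![ℓ₀, ℓ₁, 0] j.1) := fun j => by
      rw [← hχ]
      exact map_sub χ _ _
    have hlam : ∀ j : {j : Fin 3 // j ≠ i}, chartGen c i j.1 - chartBase c i (lam j) ∈ 𝔴.asIdeal := by
      intro j
      have h1 : χ (chartGen c i j.1 - chartBase c i (lam j)) ∈ maximalIdeal (X'.presheaf.stalk y) := by
        rw [hχsub]
        exact hMle (hgenM j.1)
      rw [← halg] at h1
      exact (IsLocalization.AtPrime.to_map_mem_maximal_iff (X'.presheaf.stalk y) 𝔴.asIdeal _).mp h1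
    have h𝔴eq := chart_ideal_eq_of_rational c i (hcC.trans hCst) 𝔴.asIdeal h𝔴 𝔴.isPrime.ne_top lam hlam
    have hmaxM : maximalIdeal (X'.presheaf.stalk y) ≤ M := by
      rw [← IsLocalization.AtPrime.map_eq_maximalIdeal 𝔴.asIdeal (X'.presheaf.stalk y), Ideal.map_le_iff_le_comap,
        h𝔴eq]
      refine sup_le ?_ ?_
      · rw [Ideal.span_le, Set.singleton_subset_iff, SetLike.mem_coe, Ideal.mem_comap, halg]
        exact hsM
      · rw [Ideal.span_le]
        rintro _ ⟨j, rfl⟩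
        rw [SetLike.mem_coe, Ideal.mem_comap, halg]
        show χ (chartGen c i j.1 - chartBase c i (lam j)) ∈ M
        rw [hχsub]
        exact hgenM j.1
    have hMeq : Ideal.span {s, w₁ * (v₁ * g₁), z'} = maximalIdeal (X'.presheaf.stalk y) := le_antisymm hMle hmaxM
    -- `(s, w₁v₁g₁, z')` is a regular system of parameters: THE EXIT LEMMA once more
    have hR : IsRsopPart ![s, w₁ * (v₁ * g₁), z'] := isRsopPart_triple_of_span_eq hMeq hdim3
    have hrs2 : IsRsopPart ![s, w₁ * (v₁ * g₁)] := isRsopPart_pair_of_triple hR ![0, 1] (by decide)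
    have hw₀eq : w₀ = σ c₀ * z' ^ 2 + s * (w₁ * (v₁ * g₁)) * 1 := by linear_combination hkey
    have hmem := hPP.2 hw₀I'
    rw [hw₀eq] at hmem
    exact not_mem_pPowerSpan_of_twoWall_unit 2 hrs2 isUnit_one hz'm hmem

end FreeExit

end Summit.ResolutionOfSingularities.ResolutionOfSingularities.Theorems.HugValuationCut
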